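import Summits.PneNP.PneNP.Theorems.ExpanderLinearGeneratorsMooreTree

/-!
# A Moore-type bound for `(r, 6)`-boundary expanders with `8`-point scopes, III: a short cycle
(route ExpanderLinearGenerators, item stmt-PneNP-11442, helper file)

PHASE ONE of the Moore argument. Grow the exploration tree (file II) from any row. If the labels
stay injective up to level `N` the family has at least `2^N` rows (`card_le_of_injective_labels`);
the first failure of injectivity between levels `n` and `n + 1` closes a CYCLE of the incidence
graph of length at most `4n + 6` through a row (`phaseOne_step`): the tree path between the two
colliding nodes (made a path by `bypass`) plus the one or two fresh edges of the collision
(`cycle_of_path_of_two_adj`, `cycle_of_path_of_four_adj`, `cycle_of_path_of_mem`). Hence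
(`phaseOne`): injective labels up to level `N`, or a cycle of length `≤ 4N + 2` based at a row.
-/

namespace Summit.PneNP.PneNP.Theorems

set_option linter.dupNamespace false -- `Summit.PneNP.PneNP.…`: summit = sub-problem (D-0017)

namespace MooreBound

open Finset SimpleGraph Literature.Computability.MetaComplexity

variable {ι : Type*} {S : ι → Finset ℕ} {F : Finset ι} {G : SimpleGraph (ι ⊕ ℕ)}

/-! ### Closing a path into a cycle -/

section Cycles

variable {V : Type*} {H : SimpleGraph V}

/-- A path `x₀ ⟶ x₁` with `x₀ ≠ x₁` and two further edges `x₁ — t — x₀` through a vertex `t` off the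
path close up into a cycle of length `|P| + 2` at `x₀`. [folklore] -/
theorem cycle_of_path_of_two_adj {x₀ x₁ t : V} {P : H.Walk x₀ x₁} (hP : P.IsPath) (hx : x₀ ≠ x₁)
    (ht : t ∉ P.support) (h₁ : H.Adj x₁ t) (h₂ : H.Adj t x₀) :
    ∃ Z : H.Walk x₀ x₀, Z.IsCycle ∧ Z.length = P.length + 2 := by
  refine ⟨Walk.cons h₂.symm (P.concat h₁).reverse, ?_, ?_⟩
  · rw [Walk.cons_isCycle_iff]
    refine ⟨(hP.concat ht h₁).reverse, fun hmem => ?_⟩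
    rw [Walk.edges_reverse, List.mem_reverse, Walk.edges_concat, List.concat_eq_append,
      List.mem_append, List.mem_singleton] at hmem
    rcases hmem with h | h
    · exact ht (P.snd_mem_support_of_mem_edges h)
    · rw [Sym2.eq_iff] at h
      rcases h with ⟨h, -⟩ | ⟨h, -⟩
      · exact hx h
      · exact ht (h ▸ P.start_mem_support)
  · simp

/-- A path `x₀ ⟶ x₁` and four further edges `x₁ — t₁ — t₂ — t₃ — x₀` through three distinct vertices
off the path close up into a cycle of length `|P| + 4` at `x₀`. [folklore] -/
theorem cycle_of_path_of_four_adj {x₀ x₁ t₁ t₂ t₃ : V} {P : H.Walk x₀ x₁} (hP : P.IsPath)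
    (ht₁ : t₁ ∉ P.support) (ht₂ : t₂ ∉ P.support) (ht₃ : t₃ ∉ P.support) (h₁₂ : t₁ ≠ t₂)
    (h₁₃ : t₁ ≠ t₃) (h₂₃ : t₂ ≠ t₃) (h₁ : H.Adj x₁ t₁) (h₂ : H.Adj t₁ t₂) (h₃ : H.Adj t₂ t₃)
    (h₄ : H.Adj t₃ x₀) : ∃ Z : H.Walk x₀ x₀, Z.IsCycle ∧ Z.length = P.length + 4 := by
  have hx₀ : x₀ ∈ P.support := P.start_mem_support
  have hq : (((P.concat h₁).concat h₂).concat h₃).IsPath := by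
    refine ((hP.concat ht₁ h₁).concat ?_ h₂).concat ?_ h₃
    · rw [Walk.support_concat]
      simp [ht₂, Ne.symm h₁₂]
    · rw [Walk.support_concat, Walk.support_concat]
      simp [ht₃, Ne.symm h₁₃, Ne.symm h₂₃]
  refine ⟨Walk.cons h₄.symm (((P.concat h₁).concat h₂).concat h₃).reverse, ?_, ?_⟩
  · rw [Walk.cons_isCycle_iff]
    refine ⟨hq.reverse, fun hmem => ?_⟩
    rw [Walk.edges_reverse, List.mem_reverse] at hmem
    simp only [Walk.edges_concat, List.concat_eq_append, List.mem_append, List.mem_singleton,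
      Sym2.eq_iff] at hmem
    rcases hmem with ((h | ⟨⟨-, h⟩ | ⟨h, -⟩⟩) | ⟨⟨h, -⟩ | ⟨h, -⟩⟩) | ⟨⟨h, -⟩ | ⟨h, -⟩⟩
    · exact ht₃ (P.snd_mem_support_of_mem_edges h)
    · exact h₁₃ h.symm
    · exact ht₁ (h ▸ hx₀)
    · exact ht₁ (h ▸ hx₀)
    · exact ht₂ (h ▸ hx₀)
    · exact ht₂ (h ▸ hx₀)
    · exact ht₃ (h ▸ hx₀)
  · simp

/-- A path `x₀ ⟶ x₁` through a vertex `t` adjacent to `x₀` by an edge not on the path closes up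
into a cycle of length `≤ |P| + 1` at `x₀`. [folklore] -/
theorem cycle_of_path_of_mem [DecidableEq V] {x₀ x₁ t : V} {P : H.Walk x₀ x₁} (hP : P.IsPath)
    (ht : t ∈ P.support) (h : H.Adj t x₀) (he : s(t, x₀) ∉ P.edges) :
    ∃ Z : H.Walk x₀ x₀, Z.IsCycle ∧ Z.length ≤ P.length + 1 := by
  refine ⟨Walk.cons h.symm (P.takeUntil t ht).reverse, ?_, ?_⟩
  · rw [Walk.cons_isCycle_iff]
    refine ⟨(hP.takeUntil ht).reverse, fun hmem => he ?_⟩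
    rw [Walk.edges_reverse, List.mem_reverse] at hmem
    rw [Sym2.eq_swap]
    exact P.edges_takeUntil_subset_edges ht hmem
  · have := P.length_takeUntil_le_length ht
    simp only [Walk.length_cons, Walk.length_reverse]
    omega

end Cycles

/-! ### Phase one: injective labels or a short cycle -/

section PhaseOne

variable (hG : ∀ x y, G.Adj x y ↔ ∃ a v, a ∈ F ∧ v ∈ S a ∧
  ((x = Sum.inl a ∧ y = Sum.inr v) ∨ (x = Sum.inr v ∧ y = Sum.inl a)))
variable {ρ : List Bool → ι} {φ : List Bool → ℕ}
variable (H1 : ∀ w, ρ w ∈ F)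
variable (H2 : ∀ c w, φ (c :: w) ∈ S (ρ w) ∧ φ (c :: w) ∈ S (ρ (c :: w)))
variable (H3 : ∀ c w, ρ (c :: w) ≠ ρ w)
variable (H4 : ∀ w, φ (false :: w) ≠ φ (true :: w))
variable (H5 : ∀ c c' w, φ (c :: c' :: w) ≠ φ (c' :: w))
variable [DecidableEq ι]

include hG H1 H2 H3 H4 H5

omit hG H1 H2 H3 H5 [DecidableEq ι] in
/-- Two bits that are not equal are `false` and `true`; so distinct children of a node are entered
through distinct points. [folklore] -/
theorem phi_cons_injective (w : List Bool) {c c' : Bool} (h : φ (c :: w) = φ (c' :: w)) :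
    c = c' := by
  rcases c with _ | _ <;> rcases c' with _ | _
  · rfl
  · exact absurd h (H4 w)
  · exact absurd h.symm (H4 w)
  · rfl

omit hG H1 H2 H3 H4 [DecidableEq ι] in
/-- The entry point of a child differs from the entry point of its parent (for a non-root
parent); at the root there is no entry point, and we compare with nothing. [folklore] -/
theorem phi_cons_ne_phi {c : Bool} {w : List Bool} (hw : w ≠ []) : φ (c :: w) ≠ φ w := by
  obtain ⟨c', w', rfl⟩ := List.exists_cons_of_ne_nil hw
  exact H5 c c' w'

/-- **Phase one, one level.** If the row labels are injective on nodes of length `≤ n` and the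
entry points on non-root nodes of length `≤ n`, then either both stay injective one level
further, or the incidence graph has a cycle of length `≤ 4n + 6` based at a row. [folklore] -/
theorem phaseOne_step (n : ℕ)
    (hIR : ∀ u u' : List Bool, u.length ≤ n → u'.length ≤ n → ρ u = ρ u' → u = u')
    (hIP : ∀ u u' : List Bool, u ≠ [] → u' ≠ [] → u.length ≤ n → u'.length ≤ n →
      φ u = φ u' → u = u') :
    ((∀ u u' : List Bool, u.length ≤ n + 1 → u'.length ≤ n + 1 → ρ u = ρ u' → u = u') ∧
      (∀ u u' : List Bool, u ≠ [] → u' ≠ [] → u.length ≤ n + 1 → u'.length ≤ n + 1 →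
        φ u = φ u' → u = u')) ∨
    ∃ (b : ι) (Z : G.Walk (Sum.inl b) (Sum.inl b)), Z.IsCycle ∧ Z.length ≤ 4 * n + 6 := by
  classical
  refine or_iff_not_imp_right.2 fun hno => ?_
  -- a cycle of length `≤ 4n + 6` at a row is excluded
  have hno' : ∀ (b : ι) (Z : G.Walk (Sum.inl b) (Sum.inl b)), Z.IsCycle →
      Z.length ≤ 4 * n + 6 → False := fun b Z hZ hl => hno ⟨b, Z, hZ, hl⟩
  -- tree paths and the path between two processed nodes
  have hTP := exists_treePath hG H1 H2 (ρ := ρ) (φ := φ)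
  -- between two nodes `w, w'` of length `≤ n`: a path `ρ w ⟶ ρ w'` inside their tree paths
  have hjoin : ∀ w w' : List Bool, w.length ≤ n → w'.length ≤ n →
      ∃ P : G.Walk (Sum.inl (ρ w)) (Sum.inl (ρ w')), P.IsPath ∧ P.length ≤ 4 * n ∧
        (∀ v : ℕ, (∀ u : List Bool, u ≠ [] → u.length ≤ n → φ u ≠ v) →
          Sum.inr v ∉ P.support) ∧
        (∀ a : ι, (∀ u : List Bool, u.length ≤ n → ρ u ≠ a) → Sum.inl a ∉ P.support) ∧
        (∀ e ∈ P.edges,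
          (∃ (c : Bool) (u : List Bool), (c :: u) <:+ w ∧
            (e = s(Sum.inl (ρ u), Sum.inr (φ (c :: u))) ∨
              e = s(Sum.inr (φ (c :: u)), Sum.inl (ρ (c :: u))))) ∨
          (∃ (c : Bool) (u : List Bool), (c :: u) <:+ w' ∧
            (e = s(Sum.inl (ρ u), Sum.inr (φ (c :: u))) ∨
              e = s(Sum.inr (φ (c :: u)), Sum.inl (ρ (c :: u)))))) := by
    intro w w' hw hw'
    obtain ⟨Pw, -, hsw, hew, hlw⟩ := hTP w
    obtain ⟨Pw', -, hsw', hew', hlw'⟩ := hTP w'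
    set Wk := Pw.reverse.append Pw' with hWk
    have hsuppWk : ∀ x ∈ Wk.support, x ∈ Pw.support ∨ x ∈ Pw'.support := by
      intro x hx
      rw [hWk, Walk.support_append, Walk.support_reverse, List.mem_append, List.mem_reverse]
        at hx
      exact hx.imp id (List.mem_of_mem_tail ·)
    refine ⟨Wk.bypass, Wk.bypass_isPath, ?_, ?_, ?_, ?_⟩
    · calc Wk.bypass.length ≤ Wk.length := Wk.length_bypass_le_length
        _ = Pw.length + Pw'.length := by rw [hWk, Walk.length_append, Walk.length_reverse]
        _ ≤ 4 * n := by omega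
    · intro v hv hmem
      rcases hsuppWk _ (Wk.support_bypass_subset_support hmem) with h | h
      · exact inr_notMem_support_of_fresh hw hsw hv h
      · exact inr_notMem_support_of_fresh hw' hsw' hv h
    · intro a ha hmem
      rcases hsuppWk _ (Wk.support_bypass_subset_support hmem) with h | h
      · exact inl_notMem_support_of_fresh hw hsw ha h
      · exact inl_notMem_support_of_fresh hw' hsw' ha h
    · intro e he
      have he' := Wk.edges_bypass_subset_edges he
      rw [hWk, Walk.edges_append, Walk.edges_reverse, List.mem_append, List.mem_reverse] at he'
      exact he'.imp (hew e) (hew' e)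
  -- every node of length `n + 1` is `c :: w` with `|w| = n`
  have hsplit : ∀ v : List Bool, v.length = n + 1 → ∃ c w, v = c :: w ∧ w.length = n := by
    intro v hv
    match v, hv with
    | c :: w, hv => exact ⟨c, w, rfl, by simpa using hv⟩
  ------------------------------------------------------------------
  -- Step A: entry points stay injective.
  ------------------------------------------------------------------
  -- (A1) a new entry point does not coincide with a processed one
  have hA1 : ∀ (c : Bool) (w z : List Bool), w.length = n → z ≠ [] → z.length ≤ n →
      φ (c :: w) ≠ φ z := by
    intro c w z hw hz hzn heq
    obtain ⟨cz, z', rfl⟩ := List.exists_cons_of_ne_nil hz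
    have hz'n : z'.length ≤ n := by simp at hzn; omega
    -- `z ≠ w` and `z` is not a child of `w`
    have hzw : cz :: z' ≠ w := by
      rintro rfl
      exact phi_cons_ne_phi H5 (List.cons_ne_nil cz z') heq
    have hz'w : z' ≠ w := by
      rintro rfl
      simp at hzn; omega
    -- the three rows through `y = φ z`: `ρ z'`, `ρ z`, `ρ w`
    obtain ⟨P, hP, hPl, -, -, hPe⟩ := hjoin w z' hw.le hz'n
    have hx : (Sum.inl (ρ w) : ι ⊕ ℕ) ≠ Sum.inl (ρ z') := fun h =>
      hz'w (hIR _ _ hz'n hw.le (Sum.inl_injective h).symm)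
    have h₁ : G.Adj (Sum.inl (ρ z')) (Sum.inr (φ (c :: w))) := by
      rw [heq]; exact adj_parent hG H1 H2 cz z'
    have h₂ : G.Adj (Sum.inr (φ (c :: w))) (Sum.inl (ρ w)) := (adj_parent hG H1 H2 c w).symm
    by_cases hmem : (Sum.inr (φ (c :: w)) : ι ⊕ ℕ) ∈ P.support
    · -- the point lies on the path: close up along the path
      have hedge : s((Sum.inr (φ (c :: w)) : ι ⊕ ℕ), Sum.inl (ρ w)) ∉ P.edges := by
        intro he
        have key : ∀ w'' : List Bool, w''.length ≤ n →
            (∃ (c' : Bool) (u : List Bool), (c' :: u) <:+ w'' ∧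
              (s((Sum.inr (φ (c :: w)) : ι ⊕ ℕ), Sum.inl (ρ w)) =
                  s(Sum.inl (ρ u), Sum.inr (φ (c' :: u))) ∨
                s((Sum.inr (φ (c :: w)) : ι ⊕ ℕ), Sum.inl (ρ w)) =
                  s(Sum.inr (φ (c' :: u)), Sum.inl (ρ (c' :: u))))) → False := by
          intro w'' hw'' hex
          have := eq_or_eq_cons_of_edge (ρ := ρ) (φ := φ) hIR hIP hw.le hw''
            (List.cons_ne_nil cz z') hzn hex (by rw [heq])
          rcases this with h | ⟨c', h⟩
          · exact hzw h
          · rw [h] at hzn; simp at hzn; omega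
        rcases hPe _ he with hex | hex
        · exact key w hw.le hex
        · exact key z' hz'n hex
      obtain ⟨Z, hZ, hZl⟩ := cycle_of_path_of_mem hP hmem h₂ hedge
      exact hno' _ Z hZ (by omega)
    · obtain ⟨Z, hZ, hZl⟩ := cycle_of_path_of_two_adj hP hx hmem h₁ h₂
      exact hno' _ Z hZ (by omega)
  -- (A2) two new entry points coincide only for the same node
  have hA2 : ∀ (c c' : Bool) (w w' : List Bool), w.length = n → w'.length = n →
      φ (c :: w) = φ (c' :: w') → c :: w = c' :: w' := by
    intro c c' w w' hw hw' heq
    by_cases hww : w = w'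
    · subst hww
      rw [phi_cons_injective H4 w heq]
    exfalso
    obtain ⟨P, hP, hPl, hPv, -, -⟩ := hjoin w w' hw.le hw'.le
    have hfresh : ∀ u : List Bool, u ≠ [] → u.length ≤ n → φ u ≠ φ (c :: w) :=
      fun u hu hun h => hA1 c w u hw hu hun h.symm
    have hmem := hPv _ hfresh
    have hx : (Sum.inl (ρ w) : ι ⊕ ℕ) ≠ Sum.inl (ρ w') := fun h =>
      hww (hIR _ _ hw.le hw'.le (Sum.inl_injective h))
    have h₁ : G.Adj (Sum.inl (ρ w')) (Sum.inr (φ (c :: w))) := by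
      rw [heq]; exact adj_parent hG H1 H2 c' w'
    have h₂ : G.Adj (Sum.inr (φ (c :: w))) (Sum.inl (ρ w)) := (adj_parent hG H1 H2 c w).symm
    obtain ⟨Z, hZ, hZl⟩ := cycle_of_path_of_two_adj hP hx hmem h₁ h₂
    exact hno' _ Z hZ (by omega)
  -- injectivity of entry points up to level `n + 1`
  have hIP' : ∀ u u' : List Bool, u ≠ [] → u' ≠ [] → u.length ≤ n + 1 → u'.length ≤ n + 1 →
      φ u = φ u' → u = u' := by
    intro u u' hu hu' hun hu'n heq
    rcases Nat.lt_or_ge u.length (n + 1) with hul | hul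
    · rcases Nat.lt_or_ge u'.length (n + 1) with hu'l | hu'l
      · exact hIP u u' hu hu' (by omega) (by omega) heq
      · obtain ⟨c', w', rfl, hw'⟩ := hsplit u' (le_antisymm hu'n hu'l)
        exact absurd heq.symm (hA1 c' w' u hw' hu (by omega))
    · obtain ⟨c, w, rfl, hw⟩ := hsplit u (le_antisymm hun hul)
      rcases Nat.lt_or_ge u'.length (n + 1) with hu'l | hu'l
      · exact absurd heq (hA1 c w u' hw hu' (by omega))
      · obtain ⟨c', w', rfl, hw'⟩ := hsplit u' (le_antisymm hu'n hu'l)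
        exact hA2 c c' w w' hw hw' heq
  ------------------------------------------------------------------
  -- Step B: row labels stay injective.
  ------------------------------------------------------------------
  -- (B1) a new row does not coincide with a processed one
  have hB1 : ∀ (c : Bool) (w z : List Bool), w.length = n → z.length ≤ n →
      ρ (c :: w) ≠ ρ z := by
    intro c w z hw hzn heq
    have hzw : z ≠ w := by
      rintro rfl
      exact H3 c z heq
    obtain ⟨P, hP, hPl, hPv, -, -⟩ := hjoin w z hw.le hzn
    have hfresh : ∀ u : List Bool, u ≠ [] → u.length ≤ n → φ u ≠ φ (c :: w) :=
      fun u hu hun h => hA1 c w u hw hu hun h.symm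
    have hmem := hPv _ hfresh
    have hx : (Sum.inl (ρ w) : ι ⊕ ℕ) ≠ Sum.inl (ρ z) := fun h =>
      hzw (hIR _ _ hzn hw.le (Sum.inl_injective h).symm)
    have h₁ : G.Adj (Sum.inl (ρ z)) (Sum.inr (φ (c :: w))) := by
      rw [← heq]; exact (adj_child hG H1 H2 c w).symm
    have h₂ : G.Adj (Sum.inr (φ (c :: w))) (Sum.inl (ρ w)) := (adj_parent hG H1 H2 c w).symm
    obtain ⟨Z, hZ, hZl⟩ := cycle_of_path_of_two_adj hP hx hmem h₁ h₂
    exact hno' _ Z hZ (by omega)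
  -- (B2) two new rows coincide only for the same node
  have hB2 : ∀ (c c' : Bool) (w w' : List Bool), w.length = n → w'.length = n →
      ρ (c :: w) = ρ (c' :: w') → c :: w = c' :: w' := by
    intro c c' w w' hw hw' heq
    by_contra hne
    have hyy : φ (c :: w) ≠ φ (c' :: w') := fun h =>
      hne (hIP' _ _ (List.cons_ne_nil c w) (List.cons_ne_nil c' w') (by simp [hw])
        (by simp [hw']) h)
    obtain ⟨P, hP, hPl, hPv, hPa, -⟩ := hjoin w w' hw.le hw'.le
    have ht₃ := hPv _ (fun u hu hun h => hA1 c w u hw hu hun h.symm)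
    have ht₁ := hPv _ (fun u hu hun h => hA1 c' w' u hw' hu hun h.symm)
    have ht₂ := hPa (ρ (c :: w)) (fun u hun h => hB1 c w u hw hun h.symm)
    have h₁ : G.Adj (Sum.inl (ρ w')) (Sum.inr (φ (c' :: w'))) := adj_parent hG H1 H2 c' w'
    have h₂ : G.Adj (Sum.inr (φ (c' :: w'))) (Sum.inl (ρ (c :: w))) := by
      rw [heq]; exact adj_child hG H1 H2 c' w'
    have h₃ : G.Adj (Sum.inl (ρ (c :: w))) (Sum.inr (φ (c :: w))) :=
      (adj_child hG H1 H2 c w).symm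
    have h₄ : G.Adj (Sum.inr (φ (c :: w))) (Sum.inl (ρ w)) := (adj_parent hG H1 H2 c w).symm
    obtain ⟨Z, hZ, hZl⟩ := cycle_of_path_of_four_adj hP ht₁ ht₂ ht₃ (by simp)
      (fun h => hyy (Sum.inr_injective h).symm) (by simp) h₁ h₂ h₃ h₄
    exact hno' _ Z hZ (by omega)
  -- injectivity of rows up to level `n + 1`
  have hIR' : ∀ u u' : List Bool, u.length ≤ n + 1 → u'.length ≤ n + 1 → ρ u = ρ u' →
      u = u' := by
    intro u u' hun hu'n heq
    rcases Nat.lt_or_ge u.length (n + 1) with hul | hul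
    · rcases Nat.lt_or_ge u'.length (n + 1) with hu'l | hu'l
      · exact hIR u u' (by omega) (by omega) heq
      · obtain ⟨c', w', rfl, hw'⟩ := hsplit u' (le_antisymm hu'n hu'l)
        exact absurd heq.symm (hB1 c' w' u hw' (by omega))
    · obtain ⟨c, w, rfl, hw⟩ := hsplit u (le_antisymm hun hul)
      rcases Nat.lt_or_ge u'.length (n + 1) with hu'l | hu'l
      · exact absurd heq (hB1 c w u' hw (by omega))
      · obtain ⟨c', w', rfl, hw'⟩ := hsplit u' (le_antisymm hu'n hu'l)
        exact hB2 c c' w w' hw hw' heq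
  exact ⟨hIR', hIP'⟩

/-- **Phase one.** For every `N`: either the row labels are injective on all nodes of length
`≤ N` (and the entry points on non-root ones), or the incidence graph has a cycle of length
`≤ 4N + 2` based at a row. [folklore] -/
theorem phaseOne (N : ℕ) :
    ((∀ u u' : List Bool, u.length ≤ N → u'.length ≤ N → ρ u = ρ u' → u = u') ∧
      (∀ u u' : List Bool, u ≠ [] → u' ≠ [] → u.length ≤ N → u'.length ≤ N →
        φ u = φ u' → u = u')) ∨
    ∃ (b : ι) (Z : G.Walk (Sum.inl b) (Sum.inl b)), Z.IsCycle ∧ Z.length ≤ 4 * N + 2 := by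
  induction N with
  | zero =>
    refine Or.inl ⟨fun u u' hu hu' _ => ?_, fun u u' hu _ hun _ _ => ?_⟩
    · rw [List.eq_nil_of_length_eq_zero (Nat.le_zero.1 hu),
        List.eq_nil_of_length_eq_zero (Nat.le_zero.1 hu')]
    · exact absurd (List.eq_nil_of_length_eq_zero (Nat.le_zero.1 hun)) hu
  | succ n ih =>
    rcases ih with ⟨hIR, hIP⟩ | ⟨b, Z, hZ, hl⟩
    · rcases phaseOne_step hG H1 H2 H3 H4 H5 n hIR hIP with h | ⟨b, Z, hZ, hl⟩
      · exact Or.inl h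
      · exact Or.inr ⟨b, Z, hZ, by omega⟩
    · exact Or.inr ⟨b, Z, hZ, by omega⟩

omit hG H2 H3 H4 H5 [DecidableEq ι] in
/-- **Injective labels give many rows**: if `ρ` is injective on the nodes of length `≤ N`, the
family has at least `2^N` rows (the nodes of length exactly `N` are `2^N` bit strings).
[folklore] -/
theorem card_le_of_injective_labels (N : ℕ)
    (hIR : ∀ u u' : List Bool, u.length ≤ N → u'.length ≤ N → ρ u = ρ u' → u = u') :
    2 ^ N ≤ F.card := by
  classical
  have hinj : Function.Injective fun f : Fin N → Bool => (⟨ρ (List.ofFn f), H1 _⟩ : F) := by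
    intro f g h
    have h' : ρ (List.ofFn f) = ρ (List.ofFn g) := congrArg Subtype.val h
    exact List.ofFn_injective (hIR _ _ (by simp) (by simp) h')
  have := Fintype.card_le_of_injective _ hinj
  simpa using this

end PhaseOne

end MooreBound

end Summit.PneNP.PneNP.Theorems
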